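import Literature.NumberTheory.EllipticCurves.ThreeDescentFlexAlgebra
import HarnessLib

/-!
# PART A of explicit `3`-descent, bis: the invariant liftings A2, A3 for EVERY subgroup of `GL₂(𝔽₃)`

Companion of `ThreeDescentFlexAlgebra.lean` (same grouping namespace
`Literature.NumberTheory.EllipticCurves.ThreeDescent`; `Proofs`-style: theorems, two `MonoidHom`
packagings and two `abbrev`s for the subspaces `w(M)`, `Φ(P)`; no named fact, no `sorry`). Written for
the cell `b2b-bsdres` (run/shared/lean/b2b/bsd-rank1-residual/), whose HONEST FRAMING applies to its
use there: the goal of that cell is to DELETE the COMBINATION-SHAPED residual classes for ALL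
analytic-rank `≤ 1` elliptic curves over `ℚ` — "full BSD formula for every rank `≤ 1` curve in class C"
assembled STRICTLY from published theorems — so that the rank-`≤ 1` remainder becomes exactly the
CONSTRUCTION-SHAPED classes, which are TYPED (missing-input `Prop`s), NOT attempted; this is not
"finishing BSD".

That file proved, for the explicit `𝔽₃[GL₂(𝔽₃)]`-modules `M →ʷ P →^Φ V = P ⊕ P_Y` of the
Schaefer–Stoll `3`-descent with the flex-line condition, A1 (`ker Φ = w(M)`) and the liftings
`P^{⟨t⟩} ↠ (P/w(M))^{⟨t⟩}`, `V^{⟨t⟩} ↠ (V/Φ(P))^{⟨t⟩}` at the eight elements `t` of order `3`, and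
recorded the passage to an arbitrary subgroup as prose. Here that passage is formalised, so that the
statements checked by the cell's script `partA_groupcoh.py` "for every one of the 55 subgroups
`H ≤ GL₂(𝔽₃)`" are kernel theorems quantified over `H : Subgroup (GL (Fin 2) (ZMod 3))`:

* `exists_invariant_lift_P_of_subgroup` (**A3**): if `v ∈ P` has `ρ_P(h)v − v ∈ w(M)` for all `h ∈ H`,
  then some `v − w(m')` is fixed by `H`. Equivalently `H¹(H, M) → H¹(H, P)` is injective; for `H` the
  image of `G_K` (global or local) this is the injectivity of
  `w_* : H¹(K, E[3]) → H¹(K, μ₃(Ā)) = A^×/A^{×3}` (Stoll, arXiv:math/0611694 Prop. 2.5: "one basically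
  checks all possibilities for the image of `G_K` in `GL₂(𝔽_p)`, the most interesting case being when
  the image is a `p`-Sylow subgroup"; [cite: SchaeferStoll2004, the map w]).
* `exists_invariant_lift_V_of_subgroup` (**A2**): the same for `Φ(P) ⊂ V`; equivalently
  `H¹(H, P/w(M)) →^Φ H¹(H, V)` is injective, i.e. the image of `w_*` is EXACTLY
  `ker Φ_* = {α ∈ A^×/A^{×3} : α·σ(α) ∈ A^{×3}, u(α) ∈ B^{×3}}` — the flex-line (octic algebra `B`)
  form of the image condition used by the cell's engine `desc3lib.gp`.

## Proof
`exists_fixed_translate_of_subgroup` is the general averaging lemma: for a group `H` acting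
linearly on `ι → k`, an `H`-stable subspace `W` and a subgroup `S` of finite index invertible in `k`,
the lifting property for `S` implies it for `H` (lift for `S`, then average the `S`-fixed translate
over `H/S` with `Quotient.out` representatives: `v₁ = [H:S]⁻¹ ∑_{q} ρ(q̃) v₀` is `H`-fixed because
`h q̃ = (h·q)~ s` with `s ∈ S`, and `v − v₁ ∈ W` termwise). It is applied with `S` a Sylow
`3`-subgroup of `H ≤ GL₂(𝔽₃)` (`Sylow.not_dvd_index`: `3 ∤ [H:S]`, so `[H:S] ≠ 0` in `𝔽₃`). A
`3`-subgroup `K` of `GL₂(𝔽₃)` is handled without counting (`isPGroup_three_structure`): its elements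
have cube `1` (`pow_three_eq_one_of_isPGroup`, from the kernel fact `g⁹ = 1 → g³ = 1` in `GL₂(𝔽₃)`),
and the kernel fact `mem_sylow_of_cube` (`s³ = 1 ≠ s`, `t³ = 1`, `(st)³ = 1 ⇒ t ∈ {1, s, s²}`) puts
all of `K` inside `{1, t, t²}` for one table element `t = orderThree k` — where the lifting is the
previous file's `exists_invariant_lift_P` / `exists_invariant_lift_V` (a vector fixed by `t` is fixed
by `t²`). The representations are packaged as monoid homs `rhoPHom`, `rhoVHom` on
`GL (Fin 2) (ZMod 3)` (`rhoP_mul`, `rhoY_mul`, `rhoP_one`, `rhoY_one`).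

## What is NOT here
The dictionary with Galois cohomology of fields (Kummer/Shapiro, inflation from `H` to `G_K`, the long
exact sequences turning liftings of invariants into injectivity on `H¹`) stays the paper step T1 of
`HOME/b2b-bsdres-x11b/desc3/CERTIFICATES.md` §2; it is standard and curve-free. Nothing arithmetic
(class groups, `S`-units, local images) is claimed. All `decide +kernel` calls run at default heartbeats.
-/

namespace Literature.NumberTheory.EllipticCurves.ThreeDescent

section Averaging

variable {k : Type*} [Field k] {ι : Type*} [Fintype ι] [DecidableEq ι]
variable {H : Type*} [Group H]

/-- **Averaging over cosets of a subgroup of index prime to the characteristic.** Let a group `H`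
act linearly on `ι → k` through `ρ`, let `W` be an `H`-stable subspace and `S ≤ H` a subgroup of
finite index with `[H:S] ≠ 0` in `k`. If every vector whose class modulo `W` is `S`-fixed has an
`S`-fixed translate by `W` ("`(ι → k)^S → ((ι → k)/W)^S` is onto"), then the same holds for `H`:
given `v` with `ρ(g)v − v ∈ W` for all `g ∈ H`, pick the `S`-fixed translate `v₀ = v − w₀` and average
it over coset representatives, `v₁ = [H:S]⁻¹ ∑_{q ∈ H/S} ρ(q̃)v₀`; then `v₁` is `H`-fixed and
`v − v₁ ∈ W`. (For `S = 1` this is Maschke's averaging.) [folklore] -/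
theorem exists_fixed_translate_of_subgroup (ρ : H →* Matrix ι ι k) (W : Submodule k (ι → k))
    (hW : ∀ g : H, ∀ w ∈ W, (ρ g).mulVec w ∈ W)
    (S : Subgroup H) [S.FiniteIndex] (hidx : (S.index : k) ≠ 0)
    (hS : ∀ v : ι → k, (∀ s ∈ S, (ρ s).mulVec v - v ∈ W) →
      ∃ w ∈ W, ∀ s ∈ S, (ρ s).mulVec (v - w) = v - w)
    (v : ι → k) (hv : ∀ g : H, (ρ g).mulVec v - v ∈ W) :
    ∃ w ∈ W, ∀ g : H, (ρ g).mulVec (v - w) = v - w := by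
  classical
  obtain ⟨w₀, hw₀W, hw₀⟩ := hS v (fun s _ => hv s)
  haveI : Finite (H ⧸ S) := Subgroup.finite_quotient_of_finiteIndex
  letI : Fintype (H ⧸ S) := Fintype.ofFinite _
  set v₀ : ι → k := v - w₀ with hv₀
  set c : k := ((S.index : k))⁻¹ with hc
  set v₁ : ι → k := c • ∑ q : H ⧸ S, (ρ q.out).mulVec v₀ with hv₁
  -- each representative moves `v₀` inside its `W`-class
  have hmove : ∀ g : H, (ρ g).mulVec v₀ - v₀ ∈ W := by
    intro g
    have : (ρ g).mulVec v₀ - v₀ = ((ρ g).mulVec v - v) - ((ρ g).mulVec w₀ - w₀) := by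
      simp only [hv₀, Matrix.mulVec_sub]; abel
    rw [this]
    exact W.sub_mem (hv g) (W.sub_mem (hW g w₀ hw₀W) hw₀W)
  -- index bookkeeping: `c * #(H/S) = 1`
  have hcard : (Fintype.card (H ⧸ S) : k) = (S.index : k) := by
    rw [Subgroup.index_eq_card, Nat.card_eq_fintype_card]
  have hc1 : c * (Fintype.card (H ⧸ S) : k) = 1 := by
    rw [hcard, hc, inv_mul_cancel₀ hidx]
  refine ⟨v - v₁, ?_, ?_⟩
  · -- `v - v₁ ∈ W`
    have hv' : v = c • ∑ _q : H ⧸ S, v := by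
      rw [Finset.sum_const, Finset.card_univ, ← Nat.cast_smul_eq_nsmul k, smul_smul, hc1, one_smul]
    have : v - v₁ = c • ∑ q : H ⧸ S, (v - (ρ q.out).mulVec v₀) := by
      rw [Finset.sum_sub_distrib, smul_sub, ← hv', hv₁]
    rw [this]
    refine W.smul_mem c (W.sum_mem fun q _ => ?_)
    have : v - (ρ q.out).mulVec v₀ = w₀ - ((ρ q.out).mulVec v₀ - v₀) := by
      simp only [hv₀]; abel
    rw [this]
    exact W.sub_mem hw₀W (hmove _)
  · -- `v₁` is `H`-fixed
    intro g
    rw [sub_sub_cancel, hv₁, Matrix.mulVec_smul, Matrix.mulVec_sum]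
    congr 1
    -- reindex the sum by `q ↦ g • q`
    rw [← Equiv.sum_comp (MulAction.toPerm g) (fun q : H ⧸ S => (ρ q.out).mulVec v₀)]
    refine Finset.sum_congr rfl fun q _ => ?_
    -- `(g • q).out = g * q.out * s` for some `s ∈ S`
    obtain ⟨s, hs⟩ := QuotientGroup.mk_out_eq_mul S (g * q.out)
    have hgq : ((g * q.out : H) : H ⧸ S) = g • q := by
      rw [← smul_eq_mul, MulAction.Quotient.coe_smul_out]
    simp only [MulAction.toPerm_apply]
    rw [← hgq, hs, map_mul, map_mul, ← Matrix.mulVec_mulVec, ← Matrix.mulVec_mulVec,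
      hw₀ s s.2, Matrix.mulVec_mulVec, ← map_mul]


end Averaging

section Subgroups

/-! ### Every subgroup `H ≤ GL₂(𝔽₃)`: the liftings A2, A3 of `partA_groupcoh.py` in full -/

/-- `GL₂(𝔽₃)` as the unit group of `2 × 2` matrices over `ZMod 3`. [folklore] -/
abbrev G2 := GL (Fin 2) F

/-- Units have non-zero `det2`. [folklore] -/
theorem det2_coe_ne_zero (u : G2) : det2 (u : Matrix (Fin 2) (Fin 2) F) ≠ 0 := by
  rw [det2_eq_det, ← Matrix.GeneralLinearGroup.val_det_apply]
  exact Units.ne_zero _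

/-- `rhoP 1 = 1`. [folklore] -/
theorem rhoP_one : rhoP 1 = 1 := by decide +kernel

/-- `rhoY 1 = 1`. [folklore] -/
theorem rhoY_one : rhoY 1 = 1 := by decide +kernel

/-- `rhoV 1 = 1`. [folklore] -/
theorem rhoV_one : rhoV 1 = 1 := by
  rw [rhoV, rhoP_one, rhoY_one, Matrix.fromBlocks_one]

/-- `rhoV` is multiplicative on invertible matrices. [folklore] -/
theorem rhoV_mul (g h : Matrix (Fin 2) (Fin 2) F) (hg : det2 g ≠ 0) (hh : det2 h ≠ 0) :
    rhoV (g * h) = rhoV g * rhoV h := by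
  rw [rhoV, rhoV, rhoV, Matrix.fromBlocks_multiply, rhoP_mul g h hh, rhoY_mul g h hg]
  simp

/-- Matrix form of `rhoP_mul_wM`. [folklore] -/
theorem rhoP_mul_wM' (g : Matrix (Fin 2) (Fin 2) F) (hg : det2 g ≠ 0) : rhoP g * wM = wM * g := by
  have hg' : det2 !![g 0 0, g 0 1; g 1 0, g 1 1] ≠ 0 := by rwa [← Matrix.eta_fin_two g]
  have := rhoP_mul_wM (g 0 0) (g 0 1) (g 1 0) (g 1 1) hg'
  rwa [← Matrix.eta_fin_two g] at this

/-- Matrix form of `Phi_mul_rhoP`. [folklore] -/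
theorem Phi_mul_rhoP' (g : Matrix (Fin 2) (Fin 2) F) (hg : det2 g ≠ 0) :
    Phi * rhoP g = rhoV g * Phi := by
  have hg' : det2 !![g 0 0, g 0 1; g 1 0, g 1 1] ≠ 0 := by rwa [← Matrix.eta_fin_two g]
  have := Phi_mul_rhoP (g 0 0) (g 0 1) (g 1 0) (g 1 1) hg'
  rwa [← Matrix.eta_fin_two g] at this

/-- The representation `P` of `GL₂(𝔽₃)` as a monoid hom into `8 × 8` matrices. [folklore] -/
def rhoPHom : G2 →* Matrix (Fin 8) (Fin 8) F where
  toFun u := rhoP (u : Matrix (Fin 2) (Fin 2) F)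
  map_one' := by rw [Units.val_one, rhoP_one]
  map_mul' u v := by rw [Units.val_mul]; exact rhoP_mul _ _ (det2_coe_ne_zero v)

/-- The representation `V = P ⊕ P_Y` of `GL₂(𝔽₃)` as a monoid hom. [folklore] -/
def rhoVHom : G2 →* Matrix (Fin 8 ⊕ Fin 8) (Fin 8 ⊕ Fin 8) F where
  toFun u := rhoV (u : Matrix (Fin 2) (Fin 2) F)
  map_one' := by rw [Units.val_one, rhoV_one]
  map_mul' u v := by
    rw [Units.val_mul]; exact rhoV_mul _ _ (det2_coe_ne_zero u) (det2_coe_ne_zero v)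

/-- `rhoPHom` unfolds to `rhoP`. [folklore] -/
@[simp] theorem rhoPHom_apply (u : G2) : rhoPHom u = rhoP (u : Matrix (Fin 2) (Fin 2) F) := rfl

/-- `rhoVHom` unfolds to `rhoV`. [folklore] -/
@[simp] theorem rhoVHom_apply (u : G2) : rhoVHom u = rhoV (u : Matrix (Fin 2) (Fin 2) F) := rfl

/-- In `GL₂(𝔽₃)` an element with `g⁹ = 1` has `g³ = 1` (no element of order `9`). [folklore] -/
theorem pow_three_eq_one_of_pow_nine : ∀ a b c d : F, det2 !![a, b; c, d] ≠ 0 →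
    !![a, b; c, d] ^ 9 = 1 → !![a, b; c, d] ^ 3 = 1 := by
  decide +kernel

/-- In `GL₂(𝔽₃)`: if `s` has order `3`, `t³ = 1` and `(st)³ = 1`, then `t ∈ {1, s, s²}` (two elements
of order `3` generating a group of exponent `3` lie in the same Sylow `3`-subgroup, which has order
`3`). [folklore] -/
theorem mem_sylow_of_cube : ∀ a b c d a' b' c' d' : F,
    det2 !![a, b; c, d] ≠ 0 → !![a, b; c, d] ^ 3 = 1 → !![a, b; c, d] ≠ 1 →
    !![a', b'; c', d'] ^ 3 = 1 → (!![a, b; c, d] * !![a', b'; c', d']) ^ 3 = 1 →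
    !![a', b'; c', d'] = 1 ∨ !![a', b'; c', d'] = !![a, b; c, d] ∨
      !![a', b'; c', d'] = !![a, b; c, d] ^ 2 := by
  decide +kernel

/-- Every element of a `3`-subgroup of (a subgroup of) `GL₂(𝔽₃)` has cube `1`. [folklore] -/
theorem pow_three_eq_one_of_isPGroup {H : Subgroup G2} {K : Subgroup H} (hK : IsPGroup 3 K)
    (x : H) (hx : x ∈ K) : ((x : G2) : Matrix (Fin 2) (Fin 2) F) ^ 3 = 1 := by
  obtain ⟨n, hn⟩ := hK ⟨x, hx⟩
  have hn' : ((x : G2) : Matrix (Fin 2) (Fin 2) F) ^ 3 ^ n = 1 := by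
    have := congrArg (fun y : K => (((y : H) : G2) : Matrix (Fin 2) (Fin 2) F)) hn
    simpa only [SubmonoidClass.mk_pow, Subgroup.coe_pow, Units.val_pow_eq_pow_val, Subgroup.coe_one,
      Units.val_one] using this
  -- induction on `n` using `g⁹ = 1 → g³ = 1`
  suffices key : ∀ n : ℕ, ∀ g : Matrix (Fin 2) (Fin 2) F, det2 g ≠ 0 → g ^ 3 ^ n = 1 → g ^ 3 = 1 from
    key n _ (det2_coe_ne_zero x) hn'
  intro n
  induction n with
  | zero => intro g _ hg; rw [pow_zero, pow_one] at hg; rw [hg, one_pow]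
  | succ n ih =>
    intro g hg hgn
    have h3 : det2 (g ^ 3) ≠ 0 := by
      rw [det2_eq_det, Matrix.det_pow]; exact pow_ne_zero _ (by rwa [← det2_eq_det])
    have h9 : g ^ 9 = 1 := by
      have := ih (g ^ 3) h3 (by rw [← pow_mul, ← pow_succ']; exact hgn)
      rw [← pow_mul] at this; exact this
    have hg' : det2 !![g 0 0, g 0 1; g 1 0, g 1 1] ≠ 0 := by rwa [← Matrix.eta_fin_two g]
    have := pow_three_eq_one_of_pow_nine (g 0 0) (g 0 1) (g 1 0) (g 1 1) hg'
    rw [← Matrix.eta_fin_two g] at this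
    exact this h9

/-- A vector fixed by `rhoP t` is fixed by every element of `{1, t, t²}`. [folklore] -/
theorem rhoP_mulVec_eq_of_mem_sylow {t g : Matrix (Fin 2) (Fin 2) F} (ht : det2 t ≠ 0)
    (hg : g = 1 ∨ g = t ∨ g = t ^ 2) {y : Fin 8 → F} (hy : (rhoP t).mulVec y = y) :
    (rhoP g).mulVec y = y := by
  rcases hg with rfl | rfl | rfl
  · rw [rhoP_one, Matrix.one_mulVec]
  · exact hy
  · rw [pow_two, rhoP_mul t t ht, ← Matrix.mulVec_mulVec, hy, hy]

/-- A vector fixed by `rhoV t` is fixed by every element of `{1, t, t²}`. [folklore] -/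
theorem rhoV_mulVec_eq_of_mem_sylow {t g : Matrix (Fin 2) (Fin 2) F} (ht : det2 t ≠ 0)
    (hg : g = 1 ∨ g = t ∨ g = t ^ 2) {y : Fin 8 ⊕ Fin 8 → F} (hy : (rhoV t).mulVec y = y) :
    (rhoV g).mulVec y = y := by
  rcases hg with rfl | rfl | rfl
  · rw [rhoV_one, Matrix.one_mulVec]
  · exact hy
  · rw [pow_two, rhoV_mul t t ht ht, ← Matrix.mulVec_mulVec, hy, hy]

/-- Structure of a `3`-subgroup `K` of (a subgroup of) `GL₂(𝔽₃)`: either all its elements are `1`,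
or it is contained in `{1, t, t²}` for an element `t = orderThree k` of the table. [folklore] -/
theorem isPGroup_three_structure {H : Subgroup G2} {K : Subgroup H} (hK : IsPGroup 3 K) :
    (∀ x : H, x ∈ K → ((x : G2) : Matrix (Fin 2) (Fin 2) F) = 1) ∨
    ∃ k : Fin 8, (∃ x : H, x ∈ K ∧ ((x : G2) : Matrix (Fin 2) (Fin 2) F) = orderThree k) ∧
      ∀ x : H, x ∈ K → (((x : G2) : Matrix (Fin 2) (Fin 2) F) = 1 ∨
        ((x : G2) : Matrix (Fin 2) (Fin 2) F) = orderThree k ∨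
        ((x : G2) : Matrix (Fin 2) (Fin 2) F) = orderThree k ^ 2) := by
  by_cases hall : ∀ x : H, x ∈ K → ((x : G2) : Matrix (Fin 2) (Fin 2) F) = 1
  · exact Or.inl hall
  right
  simp only [not_forall] at hall
  obtain ⟨s, hsK, hs1⟩ := hall
  set S : Matrix (Fin 2) (Fin 2) F := ((s : G2) : Matrix (Fin 2) (Fin 2) F) with hSdef
  have hS3 : S ^ 3 = 1 := pow_three_eq_one_of_isPGroup hK s hsK
  have hSdet : det2 !![S 0 0, S 0 1; S 1 0, S 1 1] ≠ 0 := by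
    rw [← Matrix.eta_fin_two S]; exact det2_coe_ne_zero _
  obtain ⟨k, hk⟩ : ∃ k : Fin 8, orderThree k = S := by
    have := exists_orderThree_eq (S 0 0) (S 0 1) (S 1 0) (S 1 1) hSdet
    rw [← Matrix.eta_fin_two S] at this
    exact this (by rw [pow_three'] at hS3; exact hS3) hs1
  refine ⟨k, ⟨s, hsK, hk.symm⟩, fun x hx => ?_⟩
  set X : Matrix (Fin 2) (Fin 2) F := ((x : G2) : Matrix (Fin 2) (Fin 2) F) with hXdef
  have hX3 : X ^ 3 = 1 := pow_three_eq_one_of_isPGroup hK x hx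
  have hSX3 : (S * X) ^ 3 = 1 := by
    have := pow_three_eq_one_of_isPGroup hK (s * x) (K.mul_mem hsK hx)
    simpa only [Subgroup.coe_mul, Units.val_mul] using this
  have key := mem_sylow_of_cube (S 0 0) (S 0 1) (S 1 0) (S 1 1) (X 0 0) (X 0 1) (X 1 0) (X 1 1)
  rw [← Matrix.eta_fin_two S, ← Matrix.eta_fin_two X] at key
  rw [hk]
  exact key (hSdef ▸ det2_coe_ne_zero _) hS3 hs1 hX3 hSX3

/-- `w(M)` as a subspace of `P = 𝔽₃⁸`. [folklore] -/
abbrev WP : Submodule F (Fin 8 → F) := LinearMap.range (wM.mulVecLin)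

/-- `Φ(P)` as a subspace of `V = 𝔽₃¹⁶`. [folklore] -/
abbrev WV : Submodule F (Fin 8 ⊕ Fin 8 → F) := LinearMap.range (Phi.mulVecLin)

/-- `w(M)` is `GL₂(𝔽₃)`-stable. [folklore] -/
theorem rhoP_mulVec_mem_WP (g : Matrix (Fin 2) (Fin 2) F) (hg : det2 g ≠ 0) (y : Fin 8 → F)
    (hy : y ∈ WP) : (rhoP g).mulVec y ∈ WP := by
  obtain ⟨m, rfl⟩ := hy
  refine ⟨g.mulVec m, ?_⟩
  simp only [Matrix.mulVecLin_apply, Matrix.mulVec_mulVec, rhoP_mul_wM' g hg]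

/-- `Φ(P)` is `GL₂(𝔽₃)`-stable. [folklore] -/
theorem rhoV_mulVec_mem_WV (g : Matrix (Fin 2) (Fin 2) F) (hg : det2 g ≠ 0) (y : Fin 8 ⊕ Fin 8 → F)
    (hy : y ∈ WV) : (rhoV g).mulVec y ∈ WV := by
  obtain ⟨φ, rfl⟩ := hy
  refine ⟨(rhoP g).mulVec φ, ?_⟩
  simp only [Matrix.mulVecLin_apply, Matrix.mulVec_mulVec, Phi_mul_rhoP' g hg]

/-- A3 for a `3`-subgroup `K` of (a subgroup of) `GL₂(𝔽₃)` (e.g. a Sylow `3`-subgroup):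
`P^K → (P/w(M))^K` is onto. [folklore] -/
theorem exists_invariant_lift_P_of_isPGroup {H : Subgroup G2} {K : Subgroup H} (hK : IsPGroup 3 K)
    (v : Fin 8 → F)
    (hv : ∀ x : H, x ∈ K → (rhoP ((x : G2) : Matrix (Fin 2) (Fin 2) F)).mulVec v - v ∈ WP) :
    ∃ w ∈ WP, ∀ x : H, x ∈ K →
      (rhoP ((x : G2) : Matrix (Fin 2) (Fin 2) F)).mulVec (v - w) = v - w := by
  rcases isPGroup_three_structure hK with hall | ⟨k, ⟨s, hsK, hs⟩, hstr⟩
  · refine ⟨0, WP.zero_mem, fun x hx => ?_⟩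
    rw [hall x hx, rhoP_one, Matrix.one_mulVec]
  · have ht : det2 (orderThree k) ≠ 0 := (orderThree_spec k).1
    obtain ⟨m, hm⟩ := hv s hsK
    rw [hs] at hm
    obtain ⟨m', hm'⟩ := exists_invariant_lift_P k v m (by
      rw [Matrix.sub_mulVec, Matrix.one_mulVec, ← hm, Matrix.mulVecLin_apply])
    refine ⟨wM.mulVec m', ⟨m', rfl⟩, fun x hx => ?_⟩
    have hfix : (rhoP (orderThree k)).mulVec (v - wM.mulVec m') = v - wM.mulVec m' := by
      rw [Matrix.sub_mulVec, Matrix.one_mulVec, sub_eq_zero] at hm'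
      exact hm'
    exact rhoP_mulVec_eq_of_mem_sylow ht (hstr x hx) hfix

/-- A2 for a `3`-subgroup `K` of (a subgroup of) `GL₂(𝔽₃)`: `V^K → (V/Φ(P))^K` is onto. [folklore] -/
theorem exists_invariant_lift_V_of_isPGroup {H : Subgroup G2} {K : Subgroup H} (hK : IsPGroup 3 K)
    (x₀ : Fin 8 ⊕ Fin 8 → F)
    (hx₀ : ∀ x : H, x ∈ K → (rhoV ((x : G2) : Matrix (Fin 2) (Fin 2) F)).mulVec x₀ - x₀ ∈ WV) :
    ∃ w ∈ WV, ∀ x : H, x ∈ K →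
      (rhoV ((x : G2) : Matrix (Fin 2) (Fin 2) F)).mulVec (x₀ - w) = x₀ - w := by
  rcases isPGroup_three_structure hK with hall | ⟨k, ⟨s, hsK, hs⟩, hstr⟩
  · refine ⟨0, WV.zero_mem, fun x hx => ?_⟩
    rw [hall x hx, rhoV_one, Matrix.one_mulVec]
  · have ht : det2 (orderThree k) ≠ 0 := (orderThree_spec k).1
    obtain ⟨φ, hφ⟩ := hx₀ s hsK
    rw [hs] at hφ
    obtain ⟨φ', hφ'⟩ := exists_invariant_lift_V k x₀ φ (by
      rw [Matrix.sub_mulVec, Matrix.one_mulVec, ← hφ, Matrix.mulVecLin_apply])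
    refine ⟨Phi.mulVec φ', ⟨φ', rfl⟩, fun x hx => ?_⟩
    have hfix : (rhoV (orderThree k)).mulVec (x₀ - Phi.mulVec φ') = x₀ - Phi.mulVec φ' := by
      rw [Matrix.sub_mulVec, Matrix.one_mulVec, sub_eq_zero] at hφ'
      exact hφ'
    exact rhoV_mulVec_eq_of_mem_sylow ht (hstr x hx) hfix

/-- **A3 for every subgroup `H ≤ GL₂(𝔽₃)`: `P^H → (P/w(M))^H` is onto** — if the class of `v ∈ P`
modulo `w(M)` is fixed by `H`, some translate `v − w(m')` is fixed by `H`. Equivalently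
`H¹(H, M) → H¹(H, P)` (induced by `w`) is injective; with `H` the image of `G_K` this is the
injectivity of `w_* : H¹(K, E[3]) → A^×/A^{×3}` (Stoll Prop. 2.5 / Schaefer–Stoll, Djabri–Schaefer–Smart).
Proof: Sylow `3`-subgroup (`exists_invariant_lift_P_of_isPGroup`) + coset averaging
(`exists_fixed_translate_of_subgroup`, index prime to `3`). [folklore] -/
theorem exists_invariant_lift_P_of_subgroup (H : Subgroup G2) (v : Fin 8 → F)
    (hv : ∀ h : G2, h ∈ H → ∃ m : Fin 2 → F,
      (rhoP (h : Matrix (Fin 2) (Fin 2) F)).mulVec v - v = wM.mulVec m) :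
    ∃ m' : Fin 2 → F, ∀ h : G2, h ∈ H →
      (rhoP (h : Matrix (Fin 2) (Fin 2) F)).mulVec (v - wM.mulVec m') = v - wM.mulVec m' := by
  classical
  let P3 : Sylow 3 H := default
  have hidx : (((P3 : Subgroup H).index : ℕ) : F) ≠ 0 := by
    intro h0
    exact P3.not_dvd_index ((ZMod.natCast_eq_zero_iff _ 3).mp h0)
  obtain ⟨w, ⟨m', rfl⟩, hw⟩ := exists_fixed_translate_of_subgroup (rhoPHom.comp H.subtype) WP
    (fun g y hy => rhoP_mulVec_mem_WP _ (det2_coe_ne_zero _) y hy)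
    (P3 : Subgroup H) hidx
    (fun v' hv' => exists_invariant_lift_P_of_isPGroup P3.isPGroup' v' (fun x hx => hv' x hx))
    v (fun g => by
      obtain ⟨m, hm⟩ := hv (g : G2) g.2
      exact ⟨m, by rw [Matrix.mulVecLin_apply, ← hm]; rfl⟩)
  exact ⟨m', fun h hh => hw ⟨h, hh⟩⟩

/-- **A2 for every subgroup `H ≤ GL₂(𝔽₃)`: `V^H → (V/Φ(P))^H` is onto** — if the class of `x ∈ V`
modulo `Φ(P)` is fixed by `H`, some translate `x − Φ(φ')` is fixed by `H`. Equivalently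
`H¹(H, P/w(M)) → H¹(H, V)` (induced by `Φ`, A1) is injective; with `H` the image of `G_K` this says
that the image of `w_*` in `A^×/A^{×3}` is exactly `{α : α·σ(α) ∈ A^{×3}, u(α) ∈ B^{×3}}` (the
flex-line form of the image condition). [folklore] -/
theorem exists_invariant_lift_V_of_subgroup (H : Subgroup G2) (x : Fin 8 ⊕ Fin 8 → F)
    (hx : ∀ h : G2, h ∈ H → ∃ φ : Fin 8 → F,
      (rhoV (h : Matrix (Fin 2) (Fin 2) F)).mulVec x - x = Phi.mulVec φ) :
    ∃ φ' : Fin 8 → F, ∀ h : G2, h ∈ H →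
      (rhoV (h : Matrix (Fin 2) (Fin 2) F)).mulVec (x - Phi.mulVec φ') = x - Phi.mulVec φ' := by
  classical
  let P3 : Sylow 3 H := default
  have hidx : (((P3 : Subgroup H).index : ℕ) : F) ≠ 0 := by
    intro h0
    exact P3.not_dvd_index ((ZMod.natCast_eq_zero_iff _ 3).mp h0)
  obtain ⟨w, ⟨φ', rfl⟩, hw⟩ := exists_fixed_translate_of_subgroup (rhoVHom.comp H.subtype) WV
    (fun g y hy => rhoV_mulVec_mem_WV _ (det2_coe_ne_zero _) y hy)
    (P3 : Subgroup H) hidx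
    (fun x' hx' => exists_invariant_lift_V_of_isPGroup P3.isPGroup' x' (fun y hy => hx' y hy))
    x (fun g => by
      obtain ⟨φ, hφ⟩ := hx (g : G2) g.2
      exact ⟨φ, by rw [Matrix.mulVecLin_apply, ← hφ]; rfl⟩)
  exact ⟨φ', fun h hh => hw ⟨h, hh⟩⟩

end Subgroups

end Literature.NumberTheory.EllipticCurves.ThreeDescent
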